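import Summits.ResolutionOfSingularities.ResolutionOfSingularities.Theorems.HilbertSamuelEliminationSigmaMaxModificationsCorridor3WLadderStrataBirthsTopDictionary
import Literature.AlgebraicGeometry.Resolution.CharPolyhedronOriginChart
import HarnessLib

/-!
# [OURS · L1 W4.2] `Corridor3WLadderStrataBirthsTopDictionaryGraded` — part 2 of the BIRTH DICTIONARY for row (b-end)₃:
# the surface-centre exclusion (proved), the CURVE-centre graded dictionary and its no-recurrence claim, the cycle-end centre
# dichotomy, and the POINT-centre datum for replay-step births

Crux chain w42 (`SigmaMaxModifications`, stmt-ResolutionOfSingularities-18506; conjunct stmt-ResolutionOfSingularities-19249), object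
«BIRTH DICTIONARY (b)₃» (res-L1-w42-plan-1 g9 07:52:17Z → res-type-067), part 2 per RULINGS v3.12-1 (C) 08:12:41Z (re-cut «CENTRE
DIMENSION») and the typer's PACE #2 (08:12:03Z) / PACE #3 (08:30:26Z + addendum 08:31:16Z). Typer res-type-067 (gen 11). OURS (cell
res-hironaka, slot W4.2); NOT statements of H. Hironaka's manuscript [Hironaka2017] nor of [CossartJannsenSaito2020]; AI-typed, weaker than
expert review. Helper file `--supports stmt-ResolutionOfSingularities-19249 --as helper` (counted 0). The one `theorem` is PROVED; every
`def … : Prop` below a docstring saying «OURS CLAIM» is a CLAIM (dictionary / cover / no-recurrence), consumed only as a hypothesis.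

STEP GEOMETRY OF RECORD (RULINGS v3.12-1 (C) = PACE #2): at the steps row (b-end)₃ constrains — BLOWN-UP CYCLE-END steps of NEVER-ISOLATED
chains with `ē = 3` — the centre is the whole treated part and its germ at `x_n` is a regular CURVE `D` or SURFACE `S`, never `{x_n}`;
births lie over the centre (part 1 / stub-4). Hence:
* (a) SURFACE germ ⇒ `ℙ(Dir_{x_n}/T_{x_n}S) = ℙ⁰` ⇒ the near fibre over `x_n` is at most ONE point ⇒ no fibre birth:
  `not_isFibreBirthAt_of_subsingleton_nearFibre` (PROVED from the subsingleton hypothesis; the confinement itself is the (H)-glue of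
  RULINGS v3.12-1, carried inside `CycleEndCentreDichotomy3`);
* (b) CURVE germ ⇒ a fibre birth is «the whole `ℙ(Dir/T_D) ≅ ℙ¹` over `x_n` is near» (a RULED birth); its graded reading in a CP frame
  ADAPTED to `D = V(X, u₁, u₂)` (`IsCPFrameAlong`) is `RuledBirthDatumD` — a purely combinatorial condition on the minimal exponent sets
  `𝐒(h_i)` of the coefficients (tree `CossartPiltant.minExponents`): «`2(m−i) ≤ ord_D h_i + a₀` on the first `D`-transversal face», i.e. the
  `D`-transversal initial forms vanish to `u₀`-order `≥ 2(m−i) − d_i` at `x_n` (typer's port of the BirthNear mechanism along `D`;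
  res-D-pv-002's T1-port word of RULINGS v3.12-1 (C) may replace it); `BirthDictionary3 p` = the scheme ↔ graded DICTIONARY CLAIM
  (∀ centre-adapted frames), `NoRuledBirth3 p` = the re-aimed no-recurrence CLAIM («no recurrent wholly-near normal `ℙ¹` over the
  centre curve», conjecture-tagged: the curve-centre K3d-type frontier), `CycleEndCentreDichotomy3 p` = the cover/confinement CLAIM
  providing, at each such step, an adapted frame (curve case) or the finite near fibre (surface case);
* (c) the POINT-centre datum `NearCurveDatumPt` / `BirthDictionary3Pt` (idea-1 C3 §8 / 002's T1 in the point-blow-up charts, initial forms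
  typed from `CossartPiltant.coeffClass` as `initialFormPoly`, near directions via `Birth.VanishesToOrder` over every field receiving
  `R/(u)`) — for births at REPLAY steps (centre `{x_n}`; consumers (c-rep)₃ / `LabelBound`), NOT for cycle ends;
* (d) the MOVING births (newborn components dominating a curve inside the centre) are object D13 (`StrataCycleEndNoMovingBirths`).
COMPOSITION OF RECORD (res-D-pv-002, D9): `BirthDictionary3 p → NoRuledBirth3 p → CycleEndCentreDichotomy3 p →
StrataCycleEndNoFibreBirths p 3 Q (3 ≤ ē)` (second case of the dichotomy through (a), with `{x_{n+1}} ∉ componentsIn` from `¬ Iso` via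
stub-4's `CycleInv.singleton_notMem_componentsIn_of_not_iso`), then part 1's `strataCycleEndBirthsSettle_of_noFibre_noMoving` with D13.
References for the modelling (nothing restated as a fact): CJS LNM 2270 Thm 3.14, Rem. 6.29 (1) [CossartJannsenSaito2020]; Cossart–Piltant
arXiv:1412.0868 Prop. 2.1, Def. 2.2–2.4, Prop. 2.6 (tree `CossartPiltant.minExponents` / `coeffClass` / `IsMinimal`) [CossartPiltant2019].
-/

noncomputable section

set_option linter.dupNamespace false

open CategoryTheory AlgebraicGeometry TopologicalSpace Topology Polynomial
open Summit.ResolutionOfSingularities.ResolutionOfSingularities.Theorems.CampaignW42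
open Literature.AlgebraicGeometry.Resolution Literature.RingTheory.HilbertSamuel
open Summit.ResolutionOfSingularities.ResolutionOfSingularities.Theorems.SigmaMaxModificationsCorridor3

namespace Summit.ResolutionOfSingularities.ResolutionOfSingularities.Theorems.SigmaMaxModificationsCorridor3.Moving

universe u

variable {N : ℕ} {ν : ℕ → ℕ}

/-! ## (a) No fibre birth when the near part of the fibre over `x_n` is at most a point -/

/-- [OURS · L1 W4.2] **No fibre birth over a point whose near fibre is at most one point.** If the near points of `x_n` on the blow-up
(the points of `X_{n+1}(ν)` over `x_n`) form a subsingleton — the case of a SURFACE centre germ at an `ē = 3` point, where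
`ℙ(Dir_{x_n}/T_{x_n}S) = ℙ⁰` (RULINGS v3.12-1 (C); the confinement itself is the (H)-glue, taken here as the hypothesis `hfin`) — and
`{x_{n+1}}` is not a component of `X_{n+1}(ν)` (never-isolated chains: stub-4 `CycleInv.singleton_notMem_componentsIn_of_not_iso`), then no
component through `x_{n+1}` is a fibre birth. [folklore] -/
theorem not_isFibreBirthAt_of_subsingleton_nearFibre {s s' : MarkedStage.{u}} {f : s'.W ⟶ s.W}
    (hfin : (f.base ⁻¹' {s.pt} ∩ Scheme.hsStratum s'.W N ν).Subsingleton)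
    (hsing : ({s'.pt} : Set s'.W) ∉ componentsIn (Scheme.hsStratum s'.W N ν)) (Z' : Set s'.W) :
    ¬ IsFibreBirthAt N ν s s' f Z' := by
  rintro ⟨⟨⟨hZ'c, hpt⟩, -⟩, hcl⟩
  apply hsing
  have hsub : Z' ⊆ f.base ⁻¹' {s.pt} ∩ Scheme.hsStratum s'.W N ν := by
    intro z hz
    refine ⟨?_, componentsIn.subset hZ'c hz⟩
    have : f.base z ∈ closure (f.base '' Z') := subset_closure ⟨z, hz, rfl⟩
    rw [hcl] at this
    exact this
  have heq : Z' = {s'.pt} := by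
    refine Set.Subset.antisymm (fun z hz => ?_) (Set.singleton_subset_iff.mpr hpt)
    exact hfin (hsub hz) (hsub hpt)
  rw [← heq]
  exact hZ'c

/-! ## (c) The POINT-centre graded datum (replay-step births) -/

section Graded

open Literature.AlgebraicGeometry.Resolution.CossartPiltant

variable {R : Type} [CommRing R]

/-- [OURS] The degree-`d` INITIAL FORM of `f ∈ R` in the regular parameters `u = (u₀,u₁,u₂)`, as a polynomial over `R ⧸ (u)`:
`Σ_{a ∈ 𝐒(f), |a| = d} γ̄(f,a) · U^a` (tree `CossartPiltant.minExponents` / `coeffClass`, CP Prop. 2.1 (ii)); for `d = ord_u f` every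
exponent of degree `d` occurring in `f` is minimal, so this IS `in_d(f)`; for other `d` it is a partial sum (not used). [folklore] -/
def initialFormPoly (u : Fin 3 → R) (f : R) (d : ℕ) : MvPolynomial (Fin 3) (R ⧸ Ideal.span (Set.range u)) :=
  ∑ a ∈ (minExponents u f).filter (fun a => ∑ j, a j = d),
    MvPolynomial.monomial (Finsupp.equivFunOnFinite.symm a) (coeffClass u f a)

/-- [OURS] The `u`-ORDER of `f`: the least total degree `|a|` over `a ∈ 𝐒(f)` (`0` if `𝐒(f) = ∅`, i.e. `f = 0`). [folklore] -/
def uOrder (u : Fin 3 → R) (f : R) : ℕ :=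
  ((minExponents u f).image fun a => ∑ j, a j).min.getD 0

/-- [OURS · L1 W4.2] **POINT-CENTRE NEAR-CURVE DATUM of a CP frame** `(R, u, h)` (`h = X^m + Σ_{i<m} h_i X^i` monic, `span u = 𝔪_R`):
a homogeneous `G ∈ κ[U₀,U₁,U₂]` of positive degree (`κ = R/(u)`, read in any field `K` receiving `κ` injectively) — a CURVE in
`ℙ(Dir) ≅ ℙ²` — all of whose non-zero `K`-points `w` are NEAR DIRECTIONS for every coefficient:
`Birth.VanishesToOrder (in_{d_i} h_i ⊗ K) w (2(m−i) − d_i)`, `d_i = ord_u h_i` (idea-1 C3 §8 (B-near) = 002's T1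
`Birth.vanishesToOrder_initialForm_of_near`, p512089, POINT-blow-up charts). The graded shadow of «a positive-dimensional family of near points
of `x_n` through `x_{n+1}` after blowing up `{x_n}`» — the event of REPLAY-step births (centre `{x_n}`), NOT of cycle-end births. [folklore] -/
def NearCurveDatumPt (u : Fin 3 → R) (h : R[X]) : Prop :=
  ∃ (g : ℕ) (G : MvPolynomial (Fin 3) (R ⧸ Ideal.span (Set.range u))), 0 < g ∧ G.IsHomogeneous g ∧ G ≠ 0 ∧
    ∀ (K : Type) [Field K] (ι : (R ⧸ Ideal.span (Set.range u)) →+* K), Function.Injective ι →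
      ∀ w : Fin 3 → K, w ≠ 0 → MvPolynomial.eval w (MvPolynomial.map ι G) = 0 →
        ∀ i < h.natDegree,
          Birth.VanishesToOrder (MvPolynomial.map ι (initialFormPoly u (h.coeff i) (uOrder u (h.coeff i)))) w
            (2 * (h.natDegree - i) - uOrder u (h.coeff i))

end Graded

/-- [OURS · L1 W4.2] **A CP FRAME of the marked stage** (the presentation clauses of `ShadowM.Reads`, C3 §4, verbatim): `R` regular local of
dimension `3` with r.s.p. `u`, `h ∈ R[X]` monic with `R[X]/(h)` local, `φ : 𝒪_{X_n,x_n} → R[X]/(h)` a flat local homomorphism generating the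
maximal ideal and surjective on residue fields, `Δ(h;u;X)` minimal (CP Def. 2.4, tree `CossartPiltant.IsMinimal`). [folklore] -/
def IsCPFrame (s : MarkedStage.{u}) (R : Type) [CommRing R] (u : Fin 3 → R) (h : R[X])
    (φ : (s.W.presheaf.stalk s.pt : Type u) →+* R[X] ⧸ Ideal.span {h}) : Prop :=
  ∃ (_ : IsRegularLocalRing R) (_ : IsLocalRing (R[X] ⧸ Ideal.span {h})),
    ringKrullDim R = 3 ∧ Ideal.span (Set.range u) = IsLocalRing.maximalIdeal R ∧ h.Monic ∧
    IsLocalHom φ ∧ φ.Flat ∧ Ideal.map φ (IsLocalRing.maximalIdeal _) = IsLocalRing.maximalIdeal _ ∧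
    Function.Surjective ((IsLocalRing.residue _).comp φ) ∧ Literature.AlgebraicGeometry.Resolution.CossartPiltant.IsMinimal u h

/-- [OURS · L1 W4.2] **POINT-CENTRE BIRTH DICTIONARY (replay steps).** Along every chain of canonical near steps from a `Q`-maximal origin
(functional admissible oracle), at every BLOWN-UP step whose canonical centre is `{x_n}` near `x_n` (an `ē = 3` stage), a FIBRE BIRTH
through `x_{n+1}` yields, in EVERY CP frame of `x_n`, a point-centre near-curve datum. OURS CLAIM (the scheme ↔ graded dictionary; NOT
proved here; consumers: (c-rep)₃ / `LabelBound`); NOT a statement of any manuscript. -/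
def BirthDictionary3Pt (p : ℕ) : Prop :=
  ∀ (R : ∀ S : Scheme.{u}, CentreSeq S → Prop), OracleFunctional R → OracleAdmissible R →
  ∀ (ν : ℕ → ℕ) (X : Scheme.{u}) [IsLocallyNoetherian X] (x : X), IsMaximalOrigin p 3 ν X x →
  ∀ (s s' : MarkedStage.{u}), Reaches R 3 ν (MarkedStage.init X x) s → CanonicalNearStep R 3 ν s s' → s.geomDirDim = 3 →
    (∀ (C : s.W.IdealSheafData) (P' : Option (Pending (blowup C))), IsCanonicalStep R 3 ν s.L s.P C P' →
      ∃ U : s.W.Opens, s.pt ∈ U ∧ (C.support : Set s.W) ∩ (U : Set s.W) = {s.pt}) →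
    ∀ (f : s'.W ⟶ s.W), StepProjection R 3 ν s s' f → ∀ Z', IsFibreBirthAt 3 ν s s' f Z' →
      ∀ (Rf : Type) (_ : CommRing Rf) (u : Fin 3 → Rf) (h : Rf[X]) (φ : (s.W.presheaf.stalk s.pt : Type u) →+* Rf[X] ⧸ Ideal.span {h}),
        IsCPFrame s Rf u h φ → NearCurveDatumPt u h


/-! ## (b) The CURVE-centre graded dictionary (cycle-end steps; RULED births) and (d) the re-aimed no-recurrence claim -/

section Curve

open Literature.AlgebraicGeometry.Resolution.CossartPiltant

variable {R : Type} [CommRing R]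

/-- [OURS · L1 W4.2] **RULED-BIRTH DATUM of a `D`-adapted CP frame** `(R, u, h)`, `h = X^m + Σ_{i<m} h_i X^i`, `D = V(X, u₁, u₂)` the centre
germ, `u₀` its parameter: for every coefficient index `i < m`, every `u₀`-FREE minimal exponent `a ∈ 𝐒(h_i)` (`a₀ = 0`, i.e. a monomial of
the restriction `h_i(0, u₁, u₂)` to the fibre over `x_n`) has transversal degree `a₁ + a₂ ≥ 2(m − i)` — equivalently «`h_i(0,U₁,U₂) = 0` or
`ord h_i(0,U₁,U₂) ≥ 2(m−i)`», the POLYHEDRON-JUMP POINT condition at `x_n ∈ D`. This is res-D-pv-002's T0c/T1c/T2c output (ANSWER 08:17:54Z,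
adopted by RULINGS v3.12-3 (P)): in the chart `U_j` (`j ∈ {1,2}`, `U₀` untouched) restriction to the fibre `U₀ = 0` commutes with the chart
(T0c), a near direction `[b] ∈ ℙ¹ = ℙ(Dir/T_D)` makes the initial form of `h_i(0,U₁,U₂)` (degree `d̄_i`) vanish to order `2(m−i) − d̄_i` at `b̂`
(T1c = binary `birthNear`), and TWO independent near directions force `d̄_i ≥ 2(2(m−i) − d̄_i)`-type collinearity, so «`ℙ¹` WHOLLY near» (a
RULED birth) with `d̄_i < 2(m−i)` forces that initial form to be `0` — impossible unless `h_i(0,U₁,U₂) = 0` (T2c = binary `birthTidy`). It implies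
the weaker wording of RULINGS v3.12-3 (P) «for `i` in the band `d_i < 2(m−i)`, the degree-`d_i` part of `h_i(0,U₁,U₂)` is `0`». Purely
combinatorial on `CossartPiltant.minExponents`; OURS; NOT proved to be equivalent to the scheme event here (that is `BirthDictionary3`). -/
def RuledBirthDatumD (u : Fin 3 → R) (h : R[X]) : Prop :=
  ∀ i < h.natDegree, ∀ a ∈ minExponents u (h.coeff i), a 0 = 0 → 2 * (h.natDegree - i) ≤ a 1 + a 2

end Curve

/-- [OURS · L1 W4.2] **A CP frame of the stage ADAPTED TO THE CENTRE `C`**: a CP frame `(R, u, h, φ)` of `x_n` (`IsCPFrame`) in which the stalk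
ideal of the centre at `x_n` becomes the coordinate ideal `(X̄, ū₁, ū₂)` of `R[X]/(h)` — the centre germ is the regular CURVE
`D = V(X, u₁, u₂)`, `u₀` its parameter. [folklore] -/
def IsCPFrameAlong (s : MarkedStage.{u}) (C : s.W.IdealSheafData) (R : Type) [CommRing R] (u : Fin 3 → R) (h : R[X])
    (φ : (s.W.presheaf.stalk s.pt : Type u) →+* R[X] ⧸ Ideal.span {h}) : Prop :=
  IsCPFrame s R u h φ ∧
    Ideal.map φ (stalkIdeal C s.pt) =
      Ideal.map (Ideal.Quotient.mk (Ideal.span {h})) (Ideal.span {X, Polynomial.C (u 1), Polynomial.C (u 2)})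

/-- [OURS · L1 W4.2] **THE CURVE-CENTRE BIRTH DICTIONARY (cycle-end steps)** — RULINGS v3.12-1 (C) re-cut. Along every chain of canonical near
steps from a `Q`-free maximal origin (functional admissible oracle), at every BLOWN-UP CYCLE-END step (`(c n).IsBlownUp`, next state `none`:
the centre is the whole treated part) from an `ē = 3` stage, for every canonical centre `C` of the step and every CP frame of `x_n` ADAPTED to
`C` (the centre germ at `x_n` is the regular curve `V(X,u₁,u₂)` of the frame): a FIBRE BIRTH through `x_{n+1}` (a newborn component of
`X_{n+1}(ν)` through `x_{n+1}` inside the fibre over `x_n`, i.e. the whole `ℙ(Dir/T_D) ≅ ℙ¹` near) yields the RULED-BIRTH DATUM of that frame.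
OURS CLAIM (the scheme ↔ graded dictionary, NOT proved here: its discharge is the BirthNear computation along `D` plus CJS Thm 3.14-type
confinement of near points to `ℙ(Dir/T_D)`); the SURFACE-centre case has no fibre births (`not_isFibreBirthAt_of_subsingleton_nearFibre` +
the (H)-glue) and the MOVING births are object D13. NOT a statement of any manuscript. -/
def BirthDictionary3 (p : ℕ) : Prop :=
  ∀ (R : ∀ S : Scheme.{u}, CentreSeq S → Prop), OracleFunctional R → OracleAdmissible R →
  ∀ (ν : ℕ → ℕ) (X : Scheme.{u}) [IsLocallyNoetherian X] (x : X), IsMaximalOrigin p 3 ν X x →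
  ∀ (s s' : MarkedStage.{u}), Reaches R 3 ν (MarkedStage.init X x) s → CanonicalNearStep R 3 ν s s' → s.geomDirDim = 3 →
    s.IsBlownUp R 3 ν → s'.P = none →
    ∀ (C : s.W.IdealSheafData) (P' : Option (Pending (blowup C))), IsCanonicalStep R 3 ν s.L s.P C P' →
    ∀ (f : s'.W ⟶ s.W), StepProjection R 3 ν s s' f → (∃ Z', IsFibreBirthAt 3 ν s s' f Z') →
      ∀ (Rf : Type) (_ : CommRing Rf) (u : Fin 3 → Rf) (h : Rf[X]) (φ : (s.W.presheaf.stalk s.pt : Type u) →+* Rf[X] ⧸ Ideal.span {h}),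
        IsCPFrameAlong s C Rf u h φ → RuledBirthDatumD u h

/-- [OURS · L1 W4.2] **NO RULED BIRTHS, EVENTUALLY** (plan-1's `NoRuledBirth3`, RULINGS v3.12-3 (P): «eventually no curve-centred cycle end of the chain
sits at a point of D where the band's D-transversal initial forms vanish (polyhedron jump point)»; the re-aimed `NoRecurrentFibreBirth3`): along every moving, never-isolated W-top chain from a `Q`-free maximal origin, from some stage on NO blown-up
cycle-end step admits a centre-adapted CP frame carrying the ruled-birth datum. OURS CLAIM — the curve-centre K3d-type frontier of row
(b-end)₃; refutable by ONE chain with ruled births at infinitely many cycle ends (specimen families: tri-1 bench / D12); conjecture-tagged: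
nothing in print or in the tree proves it. With `BirthDictionary3` it gives `StrataCycleEndNoFibreBirths p 3 Q (3 ≤ ē)` up to the
surface-centre exclusion (5-line composition, res-D-pv-002's D9 closing theorem). NOT a statement of any manuscript. -/
def NoRuledBirth3 (p : ℕ) : Prop :=
  ∀ (R : ∀ S : Scheme.{u}, CentreSeq S → Prop), OracleFunctional R → OracleAdmissible R →
  ∀ (ν : ℕ → ℕ) (X : Scheme.{u}) [IsLocallyNoetherian X] (x : X), IsMaximalOrigin p 3 ν X x →
  ∀ c : ℕ → MarkedStage.{u}, Reaches R 3 ν (MarkedStage.init X x) (c 0) →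
    (∀ n, CanonicalNearStep R 3 ν (c n) (c (n + 1))) → (∀ n, 3 ≤ (c n).geomDirDim) → (∀ n, ¬ Iso 3 (c n)) →
    (∀ n, ∃ m, n ≤ m ∧ (c m).IsBlownUp R 3 ν) →
    ∃ n₁, ∀ n, n₁ ≤ n → (c n).IsBlownUp R 3 ν → (c (n + 1)).P = none →
      ∀ (C : (c n).W.IdealSheafData) (P' : Option (Pending (blowup C))), IsCanonicalStep R 3 ν (c n).L (c n).P C P' →
      ∀ (Rf : Type) (_ : CommRing Rf) (u : Fin 3 → Rf) (h : Rf[X])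
        (φ : ((c n).W.presheaf.stalk (c n).pt : Type u) →+* Rf[X] ⧸ Ideal.span {h}),
        IsCPFrameAlong (c n) C Rf u h φ → ¬ RuledBirthDatumD u h


/-- [OURS · L1 W4.2] **CYCLE-END CENTRE DICHOTOMY at `ē = 3`** (the geometric case split of RULINGS v3.12-1 (C), as ONE named input of the
composition): along every chain as in row (b-end)₃ (moving, never isolated, `3 ≤ ē`), at every blown-up cycle-end step EITHER some canonical
centre admits a centre-adapted CP frame at `x_n` (the centre germ at `x_n` is a regular CURVE — frame existence = the COVER claim of the curve
case) OR the near fibre of the step projection over `x_n` is a subsingleton (the centre germ is a SURFACE: `ℙ(Dir_{x_n}/T_{x_n}S) = ℙ⁰`, CJS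
Thm 3.14-type confinement — the (H)-glue). OURS CLAIM (cover + confinement), NOT proved here; NOT a statement of any manuscript. With
`BirthDictionary3` (∀-form over adapted frames) and `NoRuledBirth3` it yields `StrataCycleEndNoFibreBirths p 3 Q (3 ≤ ē)` by
`not_isFibreBirthAt_of_subsingleton_nearFibre` in the second case (res-D-pv-002's D9 composition; `{x_{n+1}}` not a component ⇐ `¬ Iso` via
stub-4's `CycleInv.singleton_notMem_componentsIn_of_not_iso`). -/
def CycleEndCentreDichotomy3 (p : ℕ) : Prop :=
  ∀ (R : ∀ S : Scheme.{u}, CentreSeq S → Prop), OracleFunctional R → OracleAdmissible R →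
  ∀ (ν : ℕ → ℕ) (X : Scheme.{u}) [IsLocallyNoetherian X] (x : X), IsMaximalOrigin p 3 ν X x →
  ∀ c : ℕ → MarkedStage.{u}, Reaches R 3 ν (MarkedStage.init X x) (c 0) →
    (∀ n, CanonicalNearStep R 3 ν (c n) (c (n + 1))) → (∀ n, 3 ≤ (c n).geomDirDim) → (∀ n, ¬ Iso 3 (c n)) →
    ∀ n, (c n).IsBlownUp R 3 ν → (c (n + 1)).P = none →
      (∃ (C : (c n).W.IdealSheafData) (P' : Option (Pending (blowup C))) (Rf : Type) (_ : CommRing Rf) (u : Fin 3 → Rf)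
          (h : Rf[X]) (φ : ((c n).W.presheaf.stalk (c n).pt : Type u) →+* Rf[X] ⧸ Ideal.span {h}),
          IsCanonicalStep R 3 ν (c n).L (c n).P C P' ∧ IsCPFrameAlong (c n) C Rf u h φ) ∨
      (∀ f : (c (n + 1)).W ⟶ (c n).W, StepProjection R 3 ν (c n) (c (n + 1)) f →
          (f.base ⁻¹' {(c n).pt} ∩ Scheme.hsStratum (c (n + 1)).W 3 ν).Subsingleton)

end Summit.ResolutionOfSingularities.ResolutionOfSingularities.Theorems.SigmaMaxModificationsCorridor3.Moving

end
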